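import Summits.BirchSwinnertonDyer.BirchSwinnertonDyer.Theorems.ByReductionTypeAtTwoSupersingularSharpTwo
import Literature.Barriers.BirchSwinnertonDyer.PAdicFunctionalEquationSharpFlatTwoProofs
import Literature.NumberTheory.EllipticCurves.IwasawaAlgebraInvolution
import Literature.NumberTheory.EllipticCurves.Rank1Residual.Predicates
import HarnessLib

/-!
# Route `ThetaPartnerAtTwo` (TP2), crux K3 `SignedKatoDivisibilityUpToAtTwo` (item stmt-BirchSwinnertonDyer-20308),
# line `colemanrat` v5 — **the functional equation at 2 in K3's currency**: for a Pollack pair `(L⁺, L⁻)` at `2` of the newform of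
# `W` (good reduction, `a₂ = 0`), the Iwasawa involution `ι = IwasawaAlgebra.invol 2` (`T ↦ (1+T)⁻¹ − 1`) multiplies Kobayashi's
# `L_Ko = kobayashiL 1 L⁺ L⁻ = L⁻` by a UNIT of `Λ`; hence `(ι L_Ko) = (L_Ko)` as ideals — the last step
# `ℓ_{ι𝔭}(Λ/L♭) = ℓ_𝔭(Λ/ι L♭) = ℓ_𝔭(Λ/L♭)` of the registered stub `stub_involChainTwo` of skeleton v5.

Lead `bsd-wall-tp2-p2x` g4 (cell `bsd-wall`). HONEST FRAMING: THEOREMS ONLY — no definition, no named fact, no instance, no `sorry`;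
closes no item; BSD is NOT proved by any of this. Inputs (all tree theorems): the functional equation of Sprung's pair at `2`
(`Literature.Barriers.BirchSwinnertonDyer.exists_functionalEquation_sharp_flat_two`, stated with the coefficientwise involution
`invOnePlusSubOne`), the dictionary «at `a₂ = 0` a Pollack pair IS a Sprung pair» (`Supersingular.isSprungPair_zero_iff`), and the
Iwasawa involution file `IwasawaAlgebraInvolution` (w2's `IwasawaAlgebra.invol`, `invSubOne`).

## What is proved
* §1 `invSubOne_eq_invOnePlusSubOne`, `invol_eq_subst_invOnePlusSubOne` — the two involutions of the tree agree:
  `IwasawaAlgebra.invol p f = f.subst invOnePlusSubOne`.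
* §2 `isSprungPair_two_zero_of_isPollackPair` — a Pollack pair at `2` is a Sprung pair with `a₂ = 0`;
  `exists_isUnit_invol_kobayashiL_one_eq_mul` — `ι (kobayashiL 1 L⁺ L⁻) = u · kobayashiL 1 L⁺ L⁻`, `u ∈ Λˣ`
  (`u = w_E·(1+T)^{c+b}`); `span_invol_kobayashiL_one` — `(ι L_Ko) = (L_Ko)` as ideals of `Λ`.

References: [MazurTateTeitelbaum1986Invent] Ch. I §17; [Sprung2017] Cor. 4.14, Thm. 1.12; [GreenbergLNM1716] §1 (pp. 67–68);
[Kobayashi2003] Thm. 3.2, (3.6) (p. 7); [Pollack2003] Thm. 5.13.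
-/

set_option autoImplicit false
-- the Theorems namespace of this sub repeats the summit name by design (D-0017 nested layout)
set_option linter.dupNamespace false

noncomputable section

open scoped Classical MatrixGroups ModularForm

open CongruenceSubgroup PowerSeries WeierstrassCurve Literature.NumberTheory.EllipticCurves
  Literature.NumberTheory.EllipticCurves.ModularForms Literature.NumberTheory.EllipticCurves.Rank1Residual
  Literature.NumberTheory.EllipticCurves.Sprung2017 Literature.Barriers.BirchSwinnertonDyer
  Summit.BirchSwinnertonDyer.Rank1Residual.Supersingular

namespace Summit.BirchSwinnertonDyer.BirchSwinnertonDyer.Theorems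

namespace SignedKatoOffTwo.Invol

/-! ## §1 The two involutions of the tree agree -/

section Agree

variable (p : ℕ) [Fact p.Prime]

/-- `IwasawaAlgebra.invSubOne p = invOnePlusSubOne`: both `1 + (·)` are inverses of the unit `1 + T`. [folklore] -/
theorem invSubOne_eq_invOnePlusSubOne : IwasawaAlgebra.invSubOne p = (invOnePlusSubOne : ℤ_[p]⟦X⟧) := by
  have h1 : (1 + X : ℤ_[p]⟦X⟧) * (1 + IwasawaAlgebra.invSubOne p) = 1 := IwasawaAlgebra.one_add_X_mul_one_add_invSubOne p
  have h2 : (1 + X : ℤ_[p]⟦X⟧) * (1 + invOnePlusSubOne) = 1 := by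
    rw [add_comm (1 : ℤ_[p]⟦X⟧) invOnePlusSubOne]; exact one_add_X_mul_invOnePlusSubOne_add_one
  have hu : IsUnit (1 + X : ℤ_[p]⟦X⟧) := by
    rw [PowerSeries.isUnit_iff_constantCoeff, map_add, map_one, constantCoeff_X, add_zero]; exact isUnit_one
  have := hu.mul_left_cancel (h1.trans h2.symm)
  exact add_left_cancel this

/-- `ι f = f.subst invOnePlusSubOne` for `ι = IwasawaAlgebra.invol p`. [cite: MazurTateTeitelbaum1986Invent, Ch. I §17] -/
theorem invol_eq_subst_invOnePlusSubOne (f : IwasawaAlgebra p) :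
    IwasawaAlgebra.invol p f = f.subst (invOnePlusSubOne : ℤ_[p]⟦X⟧) := by
  rw [IwasawaAlgebra.invol_apply, invSubOne_eq_invOnePlusSubOne]

end Agree

/-! ## §2 The functional equation at `2` for Kobayashi's `L_Ko = kobayashiL 1 L⁺ L⁻` -/

section Two

variable {W : WeierstrassCurve ℚ} [W.IsElliptic] [W.IsGloballyMinimal] [NeZero (W.conductorNorm ℤ)]
  {f : CuspForm (Gamma0 (W.conductorNorm ℤ)) 2}

omit [W.IsElliptic] [W.IsGloballyMinimal] [NeZero (W.conductorNorm ℤ)] in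
/-- **A Pollack pair at `2` is a Sprung pair with `a₂ = 0`** (the congruence clauses coincide: `isSprungPair_zero_iff`).
[cite: Sprung2017, §3.1 and Cor. 4.11] [cite: Pollack2003, Prop. 6.18] -/
theorem isSprungPair_two_zero_of_isPollackPair {Lplus Lminus : IwasawaAlgebra 2} (hPP : IsPollackPair f 2 Lplus Lminus) :
    IsSprungPair f 2 0 Lplus Lminus :=
  (isSprungPair_zero_iff f 2 Lplus Lminus).2 ⟨hPP.2.2.1, hPP.2.2.2⟩

omit [W.IsElliptic] [W.IsGloballyMinimal] [NeZero (W.conductorNorm ℤ)] in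
/-- `kobayashiL 1 L⁺ L⁻ = L⁻` (Kobayashi's `+` is Pollack's `−`). [cite: Kobayashi2003, (3.6) (p. 7)] -/
theorem kobayashiL_one (Lplus Lminus : IwasawaAlgebra 2) : kobayashiL 1 Lplus Lminus = Lminus := by
  rw [kobayashiL, if_pos rfl]

/-- **The functional equation at `2` in K3's currency**: for the newform `f` of `W` (`GoodSS W 2`, `a₂ = 0`) and every Pollack pair
`(L⁺, L⁻)` at `2`, `ι (kobayashiL 1 L⁺ L⁻) = u · kobayashiL 1 L⁺ L⁻` for a unit `u = w_E · (1+T)^{c+b}` of `Λ`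
(`exists_functionalEquation_sharp_flat_two` on the Sprung pair `(L⁺, L⁻)`). [cite: MazurTateTeitelbaum1986Invent, Ch. I §17]
[cite: Sprung2017, Cor. 4.14, Thm. 1.12] [cite: GreenbergLNM1716, §1 (pp. 67–68)] -/
theorem exists_isUnit_invol_kobayashiL_one_eq_mul (hf : IsNewformOf W f) (hss : GoodSS W 2) (ha : W.frobeniusTrace 2 = 0)
    {Lplus Lminus : IwasawaAlgebra 2} (hPP : IsPollackPair f 2 Lplus Lminus) :
    ∃ u : IwasawaAlgebra 2, IsUnit u ∧
      IwasawaAlgebra.invol 2 (kobayashiL 1 Lplus Lminus) = u * kobayashiL 1 Lplus Lminus := by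
  obtain ⟨σ, hσ, -, ηN, c, a, b, -, -, -, hFE⟩ := exists_functionalEquation_sharp_flat_two hf hss.1 ha
  obtain ⟨-, hflat⟩ := hFE Lplus Lminus (isSprungPair_two_zero_of_isPollackPair hPP)
  refine ⟨(σ : IwasawaAlgebra 2) * PowerSeries.binomialSeries ℤ_[2] (c + b), ?_, ?_⟩
  · refine IsUnit.mul ?_ ?_
    · rcases hσ with rfl | rfl
      · simp
      · rw [Int.cast_neg, Int.cast_one]; exact isUnit_one.neg
    · refine isUnit_iff_exists_inv.2 ⟨PowerSeries.binomialSeries ℤ_[2] (-(c + b)), ?_⟩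
      rw [← PowerSeries.binomialSeries_add, add_neg_cancel, PowerSeries.binomialSeries_zero]
  · rw [kobayashiL_one, invol_eq_subst_invOnePlusSubOne, hflat]

/-- **`(ι L_Ko) = (L_Ko)` as ideals of `Λ`** — so `ℓ_𝔭(Λ/ι L_Ko) = ℓ_𝔭(Λ/L_Ko)` at every prime: the last step of `stub_involChainTwo`.
[cite: MazurTateTeitelbaum1986Invent, Ch. I §17] [cite: Sprung2017, Cor. 4.14] -/
theorem span_invol_kobayashiL_one (hf : IsNewformOf W f) (hss : GoodSS W 2) (ha : W.frobeniusTrace 2 = 0)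
    {Lplus Lminus : IwasawaAlgebra 2} (hPP : IsPollackPair f 2 Lplus Lminus) :
    Ideal.span {IwasawaAlgebra.invol 2 (kobayashiL 1 Lplus Lminus)} = Ideal.span {kobayashiL 1 Lplus Lminus} := by
  obtain ⟨u, hu, h⟩ := exists_isUnit_invol_kobayashiL_one_eq_mul hf hss ha hPP
  rw [h]
  exact Ideal.span_singleton_mul_left_unit hu _

end Two

end SignedKatoOffTwo.Invol

end Summit.BirchSwinnertonDyer.BirchSwinnertonDyer.Theorems

end
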